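import Summits.QuantumFields.YangMills.Theorems.FradkinShenkerFlowStrongPinningPoincareHeatBathGap

/-!
# Heat-bath Poincaré inequality from a coordinatewise Lipschitz contraction

Third file of the abstract part of `StrongPinningPoincare`. For the Gibbs measure
`μ = (lam^{⊗ι}).tilted V` and its random-scan heat-bath operator `P` we prove:

* `variance_le_of_lipContraction` — if `P` contracts coordinatewise Lipschitz seminorms
  (`Lip(P u) ≤ r Lip(u)`, `r < 1`, w.r.t. `∑ᵢ d(xᵢ, yᵢ)` for a bounded weight `d`), then every
  bounded measurable coordinatewise-Lipschitz `F` satisfies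
  `(1 - r) Var_μ(F) ≤ (2n)⁻¹ ∑ᵢ ∫∫ (F x − F(x[i↦e]))² dν_i^x dμ` (decay of iterates + the `L²`
  contraction-from-decay lemma + the Dirichlet-form identity; Ollivier's "coarse Ricci ⇒ gap"
  argument without couplings or spectral theory);
* `lipAt_randomScan` — the contraction itself from a one-site Kantorovich–Rubinstein (Vasserstein)
  Dobrushin condition `W₁(ν_i^x, ν_i^{x[j↦a]}) ≤ c i j · d(x_j, a)`, `∑_{i ≠ j} c i j ≤ 1 - κ₀`:
  then `r = 1 - κ₀ / n` (path coupling in dual form).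
-/

noncomputable section

open MeasureTheory Function Real
open scoped ENNReal

namespace Summit.QuantumFields.YangMills.Theorems.StrongPinningPoincare

namespace HeatBath

/-! ### Coordinatewise Lipschitz functions -/

section Lip

variable {ι : Type*} [Fintype ι] [DecidableEq ι] {E : Type*}

/-- **Chain bound**: a function that is `L`-Lipschitz in each coordinate separately (w.r.t. the
weight `d`) varies by at most `L ∑ⱼ d(xⱼ, yⱼ)` between any two configurations (change the
coordinates one at a time). [folklore] -/
theorem abs_sub_le_mul_sum_of_lipAt (d : E → E → ℝ) {g : (ι → E) → ℝ} {L : ℝ}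
    (hg : ∀ (x : ι → E) (j : ι) (a : E), |g (update x j a) - g x| ≤ L * d (x j) a)
    (x y : ι → E) : |g y - g x| ≤ L * ∑ j, d (x j) (y j) := by
  classical
  -- interpolate: `z S` agrees with `y` on `S` and with `x` off `S`
  set z : Finset ι → (ι → E) := fun S j => if j ∈ S then y j else x j with hz
  have hz0 : z ∅ = x := by funext j; simp [hz]
  have hz1 : z Finset.univ = y := by funext j; simp [hz]
  have hstep : ∀ (S : Finset ι) (k : ι), k ∉ S → z (insert k S) = update (z S) k (y k) := by
    intro S k hk
    funext j
    by_cases hjk : j = k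
    · subst hjk; simp [hz]
    · simp [hz, hjk]
  have key : ∀ S : Finset ι, |g (z S) - g x| ≤ L * ∑ j ∈ S, d (x j) (y j) := by
    intro S
    induction S using Finset.induction_on with
    | empty => simp [hz0]
    | insert k S hk ih =>
      rw [hstep S k hk, Finset.sum_insert hk, mul_add]
      have hzk : z S k = x k := by simp [hz, hk]
      calc |g (update (z S) k (y k)) - g x|
          ≤ |g (update (z S) k (y k)) - g (z S)| + |g (z S) - g x| := abs_sub_le _ _ _
        _ ≤ L * d (x k) (y k) + L * ∑ j ∈ S, d (x j) (y j) := by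
          refine add_le_add ?_ ih
          simpa only [hzk] using hg (z S) k (y k)
  simpa only [hz1] using key Finset.univ

/-- A function of a probability space whose oscillation is at most `K` is within `K` of its
mean. [folklore] -/
theorem abs_sub_integral_le {α : Type*} [MeasurableSpace α] (μ : Measure α)
    [IsProbabilityMeasure μ] {g : α → ℝ} (hg : Integrable g μ) {K : ℝ}
    (hK : ∀ x y, |g x - g y| ≤ K) (x : α) : |g x - ∫ y, g y ∂μ| ≤ K := by
  have h1 : g x - ∫ y, g y ∂μ = ∫ y, (g x - g y) ∂μ := by
    rw [integral_sub (integrable_const _) hg, integral_const, probReal_univ, one_smul]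
  rw [h1]
  refine (abs_integral_le_integral_abs).trans ?_
  have := integral_mono_of_nonneg (μ := μ) (ae_of_all _ fun y => abs_nonneg (g x - g y))
    (integrable_const K) (ae_of_all _ fun y => hK x y)
  simpa only [integral_const, probReal_univ, one_smul] using this

end Lip

/-! ### Poincaré inequality from the Lipschitz contraction of the random scan -/

section Poincare

variable {ι : Type*} [Fintype ι] [DecidableEq ι] [Nonempty ι] {E : Type*} [MeasurableSpace E]
  (lam : Measure E) [IsProbabilityMeasure lam] {V : (ι → E) → ℝ}

/-- **Heat-bath Poincaré inequality from a Lipschitz contraction** (Ollivier's positive coarse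
Ricci curvature ⇒ spectral gap, in a coupling-free form). Let `μ = (lam^{⊗ι}).tilted V` with
`V` bounded measurable, `P` its random-scan heat-bath operator and `d` a bounded weight on `E`.
If `P` contracts coordinatewise Lipschitz constants by a factor `r ∈ [0, 1)`, then every bounded
measurable `F` with coordinatewise Lipschitz constant `L` satisfies
`(1 - r) Var_μ(F) ≤ (2n)⁻¹ ∑ᵢ ∫∫ (F x − F(x[i↦e]))² dν_i^x(e) dμ(x)`. Proof: the iterates
`P^t (F - 𝔼F)` have mean zero and oscillation `≤ rᵗ L n D`, hence `‖P^t(F - 𝔼F)‖² ≤ (LnD)² r^{2t}`;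
`integral_mul_app_le_of_decay` gives `⟨f₀, P f₀⟩ ≤ r ‖f₀‖²`, and the Dirichlet-form identity
`∑ᵢ Qᵢ = 2n(‖f₀‖² − ⟨f₀, P f₀⟩)` concludes. [folklore] -/
theorem variance_le_of_lipContraction (hV : Measurable V) {B : ℝ} (hB : ∀ x, |V x| ≤ B)
    (d : E → E → ℝ) {D : ℝ} (hdD : ∀ e e', d e e' ≤ D) {r : ℝ} (hr0 : 0 ≤ r)
    (hcontr : ∀ (u : (ι → E) → ℝ) (L Mu : ℝ), Measurable u → (∀ x, |u x| ≤ Mu) → 0 ≤ L →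
      (∀ (x : ι → E) (j : ι) (a : E), |u (update x j a) - u x| ≤ L * d (x j) a) →
      ∀ (x : ι → E) (j : ι) (a : E),
        |(Fintype.card ι : ℝ)⁻¹ * ∑ i, ∫ e, u (update (update x j a) i e)
            ∂(lam.tilted fun e => V (update (update x j a) i e)) -
          (Fintype.card ι : ℝ)⁻¹ * ∑ i, ∫ e, u (update x i e)
            ∂(lam.tilted fun e => V (update x i e))| ≤ r * L * d (x j) a)
    {F : (ι → E) → ℝ} (hF : Measurable F) {M : ℝ} (hM : ∀ x, |F x| ≤ M) {L : ℝ} (hL0 : 0 ≤ L)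
    (hL : ∀ (x : ι → E) (j : ι) (a : E), |F (update x j a) - F x| ≤ L * d (x j) a) :
    (1 - r) * ProbabilityTheory.variance F ((Measure.pi fun _ : ι => lam).tilted V) ≤
      (2 * (Fintype.card ι : ℝ))⁻¹ * ∑ i, ∫ x, ∫ e, (F x - F (update x i e)) ^ 2
        ∂(lam.tilted fun e => V (update x i e)) ∂((Measure.pi fun _ : ι => lam).tilted V) := by
  haveI hμ := isProbabilityMeasure_gibbs lam hV hB
  have hn : (0 : ℝ) < Fintype.card ι := by exact_mod_cast Fintype.card_pos
  -- centre `F`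
  set m : ℝ := ∫ x, F x ∂((Measure.pi fun _ : ι => lam).tilted V) with hm
  have hmM : |m| ≤ M := by
    have h := norm_integral_le_of_norm_le_const (μ := (Measure.pi fun _ : ι => lam).tilted V)
      (f := F) (C := M) (ae_of_all _ fun x => by rw [Real.norm_eq_abs]; exact hM x)
    simpa only [probReal_univ, mul_one, Real.norm_eq_abs] using h
  set f₀ : (ι → E) → ℝ := fun x => F x - m with hf₀
  have hf₀m : Measurable f₀ := hF.sub_const m
  have hf₀b : ∀ x, |f₀ x| ≤ M + M := fun x =>
    (abs_sub _ _).trans (add_le_add (hM x) hmM)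
  have hf₀L : ∀ (x : ι → E) (j : ι) (a : E), |f₀ (update x j a) - f₀ x| ≤ L * d (x j) a :=
    fun x j a => by simpa only [hf₀, sub_sub_sub_cancel_right] using hL x j a
  have hFint : Integrable F ((Measure.pi fun _ : ι => lam).tilted V) := integrable_of_abs_le hF hM
  have hf₀mean : ∫ x, f₀ x ∂((Measure.pi fun _ : ι => lam).tilted V) = 0 := by
    simp only [hf₀]
    rw [integral_sub hFint (integrable_const m), integral_const, probReal_univ, one_smul, hm,
      sub_self]
  -- the random-scan operator and its iterates on `f₀`
  set P : ((ι → E) → ℝ) → ((ι → E) → ℝ) := fun u x => (Fintype.card ι : ℝ)⁻¹ *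
    ∑ i, ∫ e, u (update x i e) ∂(lam.tilted fun e => V (update x i e)) with hP
  have hit : ∀ t : ℕ, Measurable (P^[t] f₀) ∧ (∀ x, |(P^[t] f₀) x| ≤ M + M) ∧
      (∀ (x : ι → E) (j : ι) (a : E),
        |(P^[t] f₀) (update x j a) - (P^[t] f₀) x| ≤ r ^ t * L * d (x j) a) ∧
      ∫ x, (P^[t] f₀) x ∂((Measure.pi fun _ : ι => lam).tilted V) = 0 := by
    intro t
    induction t with
    | zero =>
      refine ⟨hf₀m, hf₀b, fun x j a => ?_, hf₀mean⟩
      simpa only [iterate_zero, id_eq, pow_zero, one_mul] using hf₀L x j a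
    | succ t ih =>
      obtain ⟨ihm, ihb, ihL, ihmean⟩ := ih
      rw [iterate_succ']
      refine ⟨measurable_randomScan lam hV ihm, fun x => abs_randomScan_le lam hV hB ihb x,
        fun x j a => ?_, ?_⟩
      · have h := hcontr (P^[t] f₀) (r ^ t * L) (M + M) ihm ihb
          (mul_nonneg (pow_nonneg hr0 _) hL0) ihL x j a
        calc |(P ∘ P^[t]) f₀ (update x j a) - (P ∘ P^[t]) f₀ x|
            ≤ r * (r ^ t * L) * d (x j) a := h
          _ = r ^ (t + 1) * L * d (x j) a := by ring
      · change ∫ x, P (P^[t] f₀) x ∂((Measure.pi fun _ : ι => lam).tilted V) = 0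
        rw [← ihmean]
        exact integral_randomScan lam hV hB ihm ihb
  -- mean zero + small oscillation ⇒ small sup norm ⇒ decay of `‖P^t f₀‖²`
  have hsup : ∀ (t : ℕ) (x : ι → E), |(P^[t] f₀) x| ≤ r ^ t * L * ((Fintype.card ι : ℝ) * D) := by
    intro t x
    obtain ⟨ihm, ihb, ihL, ihmean⟩ := hit t
    have hosc : ∀ x y : ι → E, |(P^[t] f₀) x - (P^[t] f₀) y| ≤
        r ^ t * L * ((Fintype.card ι : ℝ) * D) := fun x y => by
      rw [abs_sub_comm]
      refine (abs_sub_le_mul_sum_of_lipAt d ihL x y).trans ?_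
      refine mul_le_mul_of_nonneg_left ?_ (mul_nonneg (pow_nonneg hr0 _) hL0)
      calc ∑ j, d (x j) (y j) ≤ ∑ _j : ι, D := Finset.sum_le_sum fun j _ => hdD _ _
        _ = (Fintype.card ι : ℝ) * D := by
          rw [Finset.sum_const, Finset.card_univ, nsmul_eq_mul]
    have h := abs_sub_integral_le ((Measure.pi fun _ : ι => lam).tilted V)
      (integrable_of_abs_le ihm ihb) hosc x
    rwa [ihmean, sub_zero] at h
  have hdec : ∀ t : ℕ, ∫ x, ((P^[t] f₀) x) ^ 2 ∂((Measure.pi fun _ : ι => lam).tilted V) ≤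
      (L * ((Fintype.card ι : ℝ) * D)) ^ 2 * r ^ (2 * t) := fun t => by
    have hK : ∀ x, ((P^[t] f₀) x) ^ 2 ≤ (r ^ t * L * ((Fintype.card ι : ℝ) * D)) ^ 2 := fun x => by
      rw [← sq_abs]
      exact pow_le_pow_left₀ (abs_nonneg _) (hsup t x) 2
    calc ∫ x, ((P^[t] f₀) x) ^ 2 ∂((Measure.pi fun _ : ι => lam).tilted V)
        ≤ ∫ _x, (r ^ t * L * ((Fintype.card ι : ℝ) * D)) ^ 2
            ∂((Measure.pi fun _ : ι => lam).tilted V) :=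
          integral_mono_of_nonneg (ae_of_all _ fun x => sq_nonneg _) (integrable_const _)
            (ae_of_all _ hK)
      _ = (L * ((Fintype.card ι : ℝ) * D)) ^ 2 * r ^ (2 * t) := by
          rw [integral_const, probReal_univ, one_smul, pow_mul]
          ring
  -- `L²` contraction from decay: `⟨f₀, P f₀⟩ ≤ r ‖f₀‖²`
  have hgap : ∫ x, f₀ x * P f₀ x ∂((Measure.pi fun _ : ι => lam).tilted V) ≤
      r * ∫ x, f₀ x ^ 2 ∂((Measure.pi fun _ : ι => lam).tilted V) :=
    integral_mul_app_le_of_decay ((Measure.pi fun _ : ι => lam).tilted V) P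
      (fun u hu => measurable_randomScan lam hV hu)
      (fun u Mu hu x => abs_randomScan_le lam hV hB hu x)
      (fun u v Mu Mv hu hv hMu hMv => integral_randomScan_mul_comm lam hV hB hu hv hMu hMv)
      hf₀m hf₀b hr0 hdec
  -- Dirichlet-form identity for `f₀`, and `Qᵢ(F) = Qᵢ(f₀)`
  have hdir := sum_integral_integral_sq_sub_eq lam hV hB hf₀m hf₀b
  have hQ : ∀ (i : ι) (x : ι → E) (e : E),
      (F x - F (update x i e)) ^ 2 = (f₀ x - f₀ (update x i e)) ^ 2 := fun i x e => by
    simp only [hf₀, sub_sub_sub_cancel_right]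
  have hvar : ProbabilityTheory.variance F ((Measure.pi fun _ : ι => lam).tilted V) =
      ∫ x, f₀ x ^ 2 ∂((Measure.pi fun _ : ι => lam).tilted V) :=
    ProbabilityTheory.variance_eq_integral hF.aemeasurable
  simp_rw [hQ]
  rw [hdir, hvar]
  have h2n : (2 * (Fintype.card ι : ℝ))⁻¹ * (2 * (Fintype.card ι : ℝ) *
      (∫ x, f₀ x ^ 2 ∂((Measure.pi fun _ : ι => lam).tilted V) -
        ∫ x, f₀ x * P f₀ x ∂((Measure.pi fun _ : ι => lam).tilted V))) =
      ∫ x, f₀ x ^ 2 ∂((Measure.pi fun _ : ι => lam).tilted V) -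
        ∫ x, f₀ x * P f₀ x ∂((Measure.pi fun _ : ι => lam).tilted V) := by
    field_simp
  rw [h2n]
  linarith [hgap]

end Poincare

/-! ### The Lipschitz contraction from a one-site Kantorovich–Rubinstein condition -/

section Contraction

variable {ι : Type*} [Fintype ι] [DecidableEq ι] [Nonempty ι] {E : Type*} [MeasurableSpace E]
  (lam : Measure E) [IsProbabilityMeasure lam] {V : (ι → E) → ℝ}

/-- **Path coupling in dual form** (Bubley–Dyer / Dobrushin–Vasserstein, Kantorovich–Rubinstein
side): suppose the one-site heat-bath laws of `μ = (lam^{⊗ι}).tilted V` satisfy, for `i ≠ j`,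
`|∫ ψ dν_i^x − ∫ ψ dν_i^{x[j↦a]}| ≤ L · c i j · d(x_j, a)` for every bounded measurable `ψ` that
is `L`-Lipschitz for the symmetric nonnegative weight `d`, with column sums
`∑_{i ≠ j} c i j ≤ 1 − κ₀`. Then the random-scan operator `P = (1/n) ∑ᵢ P_i` contracts
coordinatewise Lipschitz constants: `Lip(P u) ≤ (1 − κ₀/n) Lip(u)`. [folklore] -/
theorem lipAt_randomScan (hV : Measurable V) {B : ℝ} (hB : ∀ x, |V x| ≤ B)
    (d : E → E → ℝ) (hd0 : ∀ e e', 0 ≤ d e e') (hdsymm : ∀ e e', d e e' = d e' e)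
    (c : ι → ι → ℝ) {κ₀ : ℝ} (hc : ∀ j, ∑ i ∈ Finset.univ.erase j, c i j ≤ 1 - κ₀)
    (hKR : ∀ (i j : ι), i ≠ j → ∀ (x : ι → E) (a : E) (ψ : E → ℝ) (L Mψ : ℝ), Measurable ψ →
      (∀ e, |ψ e| ≤ Mψ) → 0 ≤ L → (∀ e e', |ψ e - ψ e'| ≤ L * d e e') →
      |∫ e, ψ e ∂(lam.tilted fun e => V (update x i e)) -
        ∫ e, ψ e ∂(lam.tilted fun e => V (update (update x j a) i e))| ≤ L * c i j * d (x j) a)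
    (u : (ι → E) → ℝ) (L Mu : ℝ) (hu : Measurable u) (hMu : ∀ x, |u x| ≤ Mu) (hL0 : 0 ≤ L)
    (hL : ∀ (x : ι → E) (j : ι) (a : E), |u (update x j a) - u x| ≤ L * d (x j) a)
    (x : ι → E) (j : ι) (a : E) :
    |(Fintype.card ι : ℝ)⁻¹ * ∑ i, ∫ e, u (update (update x j a) i e)
        ∂(lam.tilted fun e => V (update (update x j a) i e)) -
      (Fintype.card ι : ℝ)⁻¹ * ∑ i, ∫ e, u (update x i e)
        ∂(lam.tilted fun e => V (update x i e))| ≤ (1 - κ₀ / Fintype.card ι) * L * d (x j) a := by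
  have hn : (0 : ℝ) < Fintype.card ι := by exact_mod_cast Fintype.card_pos
  set x' := update x j a with hx'
  -- termwise bounds: `0` at `i = j`, `L d (1 + c i j)` at `i ≠ j`
  set T : ι → ℝ := fun i => ∫ e, u (update x' i e) ∂(lam.tilted fun e => V (update x' i e)) -
    ∫ e, u (update x i e) ∂(lam.tilted fun e => V (update x i e)) with hT
  have hTj : T j = 0 := by
    simp only [hT, hx', update_idem, sub_self]
  have hTi : ∀ i, i ≠ j → |T i| ≤ L * d (x j) a + L * c i j * d (x j) a := by
    intro i hij
    haveI := isProbabilityMeasure_heatBath lam hV hB x i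
    -- `ψ e = u (x'[i↦e])` is `L`-Lipschitz, bounded, measurable
    have hψm : Measurable fun e => u (update x' i e) := hu.comp (measurable_update x')
    have hψb : ∀ e, |u (update x' i e)| ≤ Mu := fun e => hMu _
    have hψL : ∀ e e', |u (update x' i e) - u (update x' i e')| ≤ L * d e e' := fun e e' => by
      have h := hL (update x' i e') i e
      rw [update_idem, update_self] at h
      rwa [hdsymm e' e] at h
    -- split `T i` into a law difference and an integrand difference
    have hφm : Measurable fun e => u (update x i e) := hu.comp (measurable_update x)
    have i1 : Integrable (fun e => u (update x' i e)) (lam.tilted fun e => V (update x i e)) :=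
      integrable_of_abs_le hψm hψb
    have i2 : Integrable (fun e => u (update x i e)) (lam.tilted fun e => V (update x i e)) :=
      integrable_of_abs_le hφm fun e => hMu _
    have hsplit : T i = (∫ e, u (update x' i e) ∂(lam.tilted fun e => V (update x' i e)) -
        ∫ e, u (update x' i e) ∂(lam.tilted fun e => V (update x i e))) +
        ∫ e, (u (update x' i e) - u (update x i e)) ∂(lam.tilted fun e => V (update x i e)) := by
      simp only [hT]
      rw [integral_sub i1 i2]
      ring
    have hlaw : |∫ e, u (update x' i e) ∂(lam.tilted fun e => V (update x' i e)) -
        ∫ e, u (update x' i e) ∂(lam.tilted fun e => V (update x i e))| ≤ L * c i j * d (x j) a := by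
      rw [abs_sub_comm]
      exact hKR i j hij x a _ L Mu hψm hψb hL0 hψL
    have hpt : ∀ e, |u (update x' i e) - u (update x i e)| ≤ L * d (x j) a := fun e => by
      have hcomm : update x' i e = update (update x i e) j a := by
        rw [hx', update_comm (Ne.symm hij)]
      have h := hL (update x i e) j a
      rwa [update_of_ne (Ne.symm hij), ← hcomm] at h
    have hintg : |∫ e, (u (update x' i e) - u (update x i e)) ∂(lam.tilted fun e => V (update x i e))|
        ≤ L * d (x j) a := by
      refine (abs_integral_le_integral_abs).trans ?_
      have := integral_mono_of_nonneg (μ := lam.tilted fun e => V (update x i e))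
        (ae_of_all _ fun e => abs_nonneg (u (update x' i e) - u (update x i e)))
        (integrable_const (L * d (x j) a)) (ae_of_all _ hpt)
      simpa only [integral_const, probReal_univ, one_smul] using this
    rw [hsplit]
    calc _ ≤ |∫ e, u (update x' i e) ∂(lam.tilted fun e => V (update x' i e)) -
          ∫ e, u (update x' i e) ∂(lam.tilted fun e => V (update x i e))| +
          |∫ e, (u (update x' i e) - u (update x i e)) ∂(lam.tilted fun e => V (update x i e))| :=
        abs_add_le _ _
      _ ≤ L * c i j * d (x j) a + L * d (x j) a := add_le_add hlaw hintg
      _ = L * d (x j) a + L * c i j * d (x j) a := add_comm _ _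
  -- sum the termwise bounds
  have hdiff : (Fintype.card ι : ℝ)⁻¹ * ∑ i, ∫ e, u (update x' i e)
        ∂(lam.tilted fun e => V (update x' i e)) -
      (Fintype.card ι : ℝ)⁻¹ * ∑ i, ∫ e, u (update x i e) ∂(lam.tilted fun e => V (update x i e))
      = (Fintype.card ι : ℝ)⁻¹ * ∑ i, T i := by
    rw [← mul_sub, ← Finset.sum_sub_distrib]
  rw [hdiff, abs_mul, abs_inv, abs_of_pos hn]
  have hsum : |∑ i, T i| ≤ ((Fintype.card ι : ℝ) - κ₀) * (L * d (x j) a) := by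
    have h1 : ∑ i, T i = ∑ i ∈ Finset.univ.erase j, T i := by
      rw [← Finset.sum_erase_add _ _ (Finset.mem_univ j), hTj, add_zero]
    rw [h1]
    refine (Finset.abs_sum_le_sum_abs _ _).trans ?_
    calc ∑ i ∈ Finset.univ.erase j, |T i|
        ≤ ∑ i ∈ Finset.univ.erase j, (L * d (x j) a + L * c i j * d (x j) a) :=
          Finset.sum_le_sum fun i hi => hTi i (Finset.ne_of_mem_erase hi)
      _ = ((Finset.univ.erase j).card + ∑ i ∈ Finset.univ.erase j, c i j) * (L * d (x j) a) := by
          rw [Finset.sum_add_distrib, Finset.sum_const, nsmul_eq_mul, add_mul, Finset.sum_mul]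
          congr 1
          exact Finset.sum_congr rfl fun i _ => by ring
      _ ≤ ((Fintype.card ι : ℝ) - 1 + (1 - κ₀)) * (L * d (x j) a) := by
          refine mul_le_mul_of_nonneg_right (add_le_add ?_ (hc j)) (mul_nonneg hL0 (hd0 _ _))
          rw [Finset.card_erase_of_mem (Finset.mem_univ j), Finset.card_univ]
          push_cast [Nat.cast_sub Fintype.card_pos]
          exact le_rfl
      _ = ((Fintype.card ι : ℝ) - κ₀) * (L * d (x j) a) := by ring
  calc (Fintype.card ι : ℝ)⁻¹ * |∑ i, T i|
      ≤ (Fintype.card ι : ℝ)⁻¹ * (((Fintype.card ι : ℝ) - κ₀) * (L * d (x j) a)) :=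
        mul_le_mul_of_nonneg_left hsum (inv_nonneg.2 hn.le)
    _ = (1 - κ₀ / Fintype.card ι) * L * d (x j) a := by
        field_simp

end Contraction

end HeatBath

end Summit.QuantumFields.YangMills.Theorems.StrongPinningPoincare

end
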